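import Literature.NumberTheory.EllipticCurves.EichlerShimuraConstruction
import Literature.NumberTheory.EllipticCurves.CuspFormLFunction
import Literature.NumberTheory.EllipticCurves.ModularCurveManinConstantProofs
import Literature.NumberTheory.EllipticCurves.ModularParametrizationDegree
import HarnessLib

/-!
# Route `SylvesterTwoHeegnerIndex` (rung K7t): RIGIDITY of `ModularParametrizationData W N` — the ratio `deg / c²`
# is an invariant of `(W, N)`; equal degrees force `φ' = ±φ` (input of the print-exact form of (G3), crux
# `UpperOffV0HSYPlus` stmt-BirchSwinnertonDyer-19804 / hand item stmt-…-19229; planner D847 «(G3-MIN)»)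

Cell `bsd-cm`, seat `bsd-cm-k7t-c2` g35.  THEOREMS ONLY (general `W/ℚ`, level `N`): no definition, no named fact, no
instance, no notation, no `sorry`.  `--supports stmt-BirchSwinnertonDyer-19804 --as helper`; consumer:
`Theorems/SylvesterTwoHeegnerIndexUpperConeOfPrintExact.lean` ((G3) ⟸ (G3′) and the K7t UPPER cone from print-exact inputs).

## What is proved

Two data `D D' : ModularParametrizationData W N` have the same newform (`q`-expansion principle, `IsNewformOf.unique`),
the same Néron lattice (uniformisation theorem, uniqueness half, `IsNeronLatticeOf.lattice_eq`) and hence the same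
uniformisation `ℂ →+ E(ℂ)` (`uniformize_eq`: `℘[Λ]` depends on `Λ` only); so `φ_{D'} = u (c' · ∫ f)` differs from
`φ_D = u (c · ∫ f)` only through the Manin constant (`φ_eq_uniformize`).  THE SYMMETRIC PUMP: `|c'| • φ_D = ±(|c| • φ_{D'})`
pointwise (`natAbs_smul_φ_eq_or`); the cofinite fibre count of `k • φ_D` over `Y₀(N)` is `k² · deg D` (the `k`-division
translates through `uniformize`, `Γ₀(N)`-invariance `φ_gamma0_smul_holds'` — UNCONDITIONAL in the tree;
`finite_setOf_card_fibre_smul_ne`); negation moves an exceptional set by `P ↦ −P`; a cofinite fibre count is unique since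
`E(ℂ)` is infinite (`cofinite_count_unique`).  Whence the **rigidity identity** `|c'|² · deg D = |c|² · deg D'`
(★ `natAbs_maninConstant_sq_mul_deg_eq`, `maninConstant_sq_mul_deg_eq`), and at equal degree `c' = ±c`, `φ_{D'} = ±φ_D`
(★ `maninConstant_eq_or_eq_neg_of_deg_eq`, `φ_eq_or_eq_neg_of_deg_eq`); also `c' = m c ⟹ φ_{D'} = m • φ_D`.
The fibre-count lemmas are adapted from `Summits/ABC/ABC/Theorems/DegreePrimesPolyBounded/Negative/Pump.lean` (that module
is outside the farm's prebuilt closure; its `fib`/`tors` abbreviations are written out here); NEW is the symmetric comparison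
of two data (no minimal datum, no «shrink», no squarefreeness hypothesis on the degree).

Honest label: infrastructure about the hypothesis structure `ModularParametrizationData`; nothing curve-specific; BSD untouched.

## References

* B. Edixhoven, *On the Manin constants of modular elliptic curves* (1991), §1 (`c Λ_f ⊆ Λ_E`). [EdixhovenManin1991]
* J. E. Cremona, *Algorithms for Modular Elliptic Curves*, 2nd ed. (1997), §2.10 (`φ`, modular degree). [CremonaAlgorithms1997]
* J. H. Silverman, *The Arithmetic of Elliptic Curves*, 2nd ed. (2009), VI.3.6, VI.5.1. [SilvermanAEC2009]
* F. Diamond, J. Shurman, *A First Course in Modular Forms* (2005), §5.8 (`q`-expansion principle), §6.6. [DiamondShurman2005]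
-/

set_option linter.dupNamespace false -- Summits modules are `Summit.<Summit>.<Problem>…` by design
set_option autoImplicit false

noncomputable section

open scoped Classical MatrixGroups

open WeierstrassCurve CongruenceSubgroup UpperHalfPlane
open Literature.NumberTheory.EllipticCurves Literature.NumberTheory.EllipticCurves.ModularForms

namespace Summit.BirchSwinnertonDyer.BirchSwinnertonDyer.Theorems.SylvesterTwoParamRigidity

/-! ## §1 Rigidity of `ModularParametrizationData W N` -/

section Fibres

variable {W : WeierstrassCurve ℚ} {N : ℕ} [NeZero N] (D : ModularParametrizationData W N)

/-- Two points of `ℂ` have the same image in `E(ℂ)` iff they differ by a period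
(adapted from `Summits/ABC/…/Pump.lean`). [folklore] -/
theorem uniformize_eq_uniformize_iff (a b : ℂ) : D.uniformize a = D.uniformize b ↔ a - b ∈ D.L.lattice := by
  rw [← sub_eq_zero, ← map_sub, D.uniformize_eq_zero_iff]

/-- `(m ω₁ + n ω₂)/k ∈ Λ ↔ k ∣ m ∧ k ∣ n` (adapted from `Summits/ABC/…/Pump.lean`). [folklore] -/
theorem div_mem_lattice_iff (L : PeriodPair) (m n : ℤ) {k : ℕ} (hk : k ≠ 0) :
    ((m : ℂ) * L.ω₁ + (n : ℂ) * L.ω₂) / (k : ℂ) ∈ L.lattice ↔ (k : ℤ) ∣ m ∧ (k : ℤ) ∣ n := by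
  have hk' : (k : ℤ) ≠ 0 := by exact_mod_cast hk
  have h := @PeriodPair.mul_ω₁_add_mul_ω₂_mem_lattice L ((m : ℚ) / ((k : ℤ) : ℚ)) ((n : ℚ) / ((k : ℤ) : ℚ))
  rw [Rat.den_div_intCast_eq_one_iff _ _ hk', Rat.den_div_intCast_eq_one_iff _ _ hk'] at h
  rw [← h]
  push_cast
  ring_nf

/-- Each `k`-division translate `u((z₀ + iω₁ + jω₂)/k)` is a `k`-th root of `u z₀`
(adapted from `Summits/ABC/…/Pump.lean`, `smul_tors`). [folklore] -/
theorem smul_translate (z₀ : ℂ) {k : ℕ} (hk : k ≠ 0) (x : Fin k × Fin k) :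
    k • D.uniformize ((z₀ + ((x.1 : ℕ) : ℂ) * D.L.ω₁ + ((x.2 : ℕ) : ℂ) * D.L.ω₂) / (k : ℂ)) = D.uniformize z₀ := by
  rw [← map_nsmul, nsmul_eq_mul, mul_div_cancel₀ _ (Nat.cast_ne_zero.mpr hk), add_assoc, map_add]
  have := (D.uniformize_eq_zero_iff _).mpr
    (PeriodPair.mem_lattice.mpr ⟨((x.1 : ℕ) : ℤ), ((x.2 : ℕ) : ℤ), rfl⟩ : _ ∈ D.L.lattice)
  push_cast at this
  rw [this, add_zero]

/-- The `k²` translates are pairwise distinct (adapted from `Summits/ABC/…/Pump.lean`, `tors_injective`). [folklore] -/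
theorem translate_injective (z₀ : ℂ) {k : ℕ} (hk : k ≠ 0) :
    Function.Injective fun x : Fin k × Fin k ↦
      D.uniformize ((z₀ + ((x.1 : ℕ) : ℂ) * D.L.ω₁ + ((x.2 : ℕ) : ℂ) * D.L.ω₂) / (k : ℂ)) := by
  intro x x' h
  dsimp only at h
  rw [uniformize_eq_uniformize_iff] at h
  have key : (((((x.1 : ℕ) : ℤ) - ((x'.1 : ℕ) : ℤ) : ℤ) : ℂ) * D.L.ω₁
      + ((((x.2 : ℕ) : ℤ) - ((x'.2 : ℕ) : ℤ) : ℤ) : ℂ) * D.L.ω₂) / (k : ℂ) ∈ D.L.lattice := by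
    convert h using 1
    push_cast
    ring
  rw [div_mem_lattice_iff _ _ _ hk] at key
  obtain ⟨h1, h2⟩ := key
  have e1 : (x'.1 : ℕ) = (x.1 : ℕ) :=
    Nat.ModEq.eq_of_lt_of_lt (Nat.modEq_iff_dvd.mpr h1) x'.1.isLt x.1.isLt
  have e2 : (x'.2 : ℕ) = (x.2 : ℕ) :=
    Nat.ModEq.eq_of_lt_of_lt (Nat.modEq_iff_dvd.mpr h2) x'.2.isLt x.2.isLt
  exact Prod.ext (Fin.ext e1.symm) (Fin.ext e2.symm)

/-- Every `Q` with `k • Q = u z₀` is one of the `k²` translates (adapted from `Summits/ABC/…/Pump.lean`,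
`exists_tors_eq`). [folklore] -/
theorem exists_translate_eq (z₀ : ℂ) {k : ℕ} (hk : k ≠ 0) {Q : (W.baseChange ℂ).toAffine.Point}
    (hQ : k • Q = D.uniformize z₀) :
    ∃ x : Fin k × Fin k, D.uniformize ((z₀ + ((x.1 : ℕ) : ℂ) * D.L.ω₁ + ((x.2 : ℕ) : ℂ) * D.L.ω₂) / (k : ℂ)) = Q := by
  obtain ⟨w, rfl⟩ := D.uniformize_surjective Q
  rw [← map_nsmul, nsmul_eq_mul, uniformize_eq_uniformize_iff] at hQ
  obtain ⟨m, n, hmn⟩ := PeriodPair.mem_lattice.mp hQ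
  have hk' : (0 : ℤ) < k := by exact_mod_cast Nat.pos_of_ne_zero hk
  have hi0 : 0 ≤ m % k := Int.emod_nonneg _ hk'.ne'
  have hj0 : 0 ≤ n % k := Int.emod_nonneg _ hk'.ne'
  have hi : (m % k).toNat < k := by
    have := Int.emod_lt_of_pos m hk'
    omega
  have hj : (n % k).toNat < k := by
    have := Int.emod_lt_of_pos n hk'
    omega
  refine ⟨(⟨(m % k).toNat, hi⟩, ⟨(n % k).toNat, hj⟩), ?_⟩
  rw [uniformize_eq_uniformize_iff]
  refine PeriodPair.mem_lattice.mpr ⟨-(m / k), -(n / k), ?_⟩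
  have ei : (((m % k).toNat : ℕ) : ℂ) = (m : ℂ) - (k : ℂ) * ((m / k : ℤ) : ℂ) := by
    have h1 : (((m % k).toNat : ℕ) : ℤ) = m % k := Int.toNat_of_nonneg hi0
    have h2 : m % k = m - k * (m / k) := Int.emod_def m k
    have : (((m % k).toNat : ℕ) : ℂ) = (((((m % k).toNat : ℕ) : ℤ)) : ℂ) := by push_cast; rfl
    rw [this, h1, h2]; push_cast; ring
  have ej : (((n % k).toNat : ℕ) : ℂ) = (n : ℂ) - (k : ℂ) * ((n / k : ℤ) : ℂ) := by
    have h1 : (((n % k).toNat : ℕ) : ℤ) = n % k := Int.toNat_of_nonneg hj0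
    have h2 : n % k = n - k * (n / k) := Int.emod_def n k
    have : (((n % k).toNat : ℕ) : ℂ) = (((((n % k).toNat : ℕ) : ℤ)) : ℂ) := by push_cast; rfl
    rw [this, h1, h2]; push_cast; ring
  have hkC : (k : ℂ) ≠ 0 := Nat.cast_ne_zero.mpr hk
  have hw : (k : ℂ) * w = z₀ + (m : ℂ) * D.L.ω₁ + (n : ℂ) * D.L.ω₂ := by linear_combination -hmn
  rw [ei, ej, eq_sub_iff_add_eq, eq_div_iff hkC]
  push_cast
  linear_combination hw

/-- The fibre of `k • φ` over `u z₀` is the union of the fibres of `φ` over the `k²` translates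
(adapted from `Summits/ABC/…/Pump.lean`, `setOf_fibre_smul_eq`). [folklore] -/
theorem setOf_fibre_smul_eq (z₀ : ℂ) {k : ℕ} (hk : k ≠ 0) :
    {y : Y0 N | ∃ τ : ℍ, Y0.mk N τ = y ∧ k • D.φ τ = D.uniformize z₀}
      = ⋃ x : Fin k × Fin k, {y : Y0 N | ∃ τ : ℍ, Y0.mk N τ = y ∧
          D.φ τ = D.uniformize ((z₀ + ((x.1 : ℕ) : ℂ) * D.L.ω₁ + ((x.2 : ℕ) : ℂ) * D.L.ω₂) / (k : ℂ))} := by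
  ext y
  simp only [Set.mem_setOf_eq, Set.mem_iUnion]
  constructor
  · rintro ⟨τ, hy, hτ⟩
    obtain ⟨x, hx⟩ := exists_translate_eq D z₀ hk hτ
    exact ⟨x, τ, hy, hx.symm⟩
  · rintro ⟨x, τ, hy, hτ⟩
    exact ⟨τ, hy, by rw [hτ, smul_translate D z₀ hk x]⟩

/-- Fibres of `φ` over distinct translates are disjoint — `φ` is `Γ₀(N)`-invariant UNCONDITIONALLY
(`φ_gamma0_smul_holds'`) (adapted from `Summits/ABC/…/Pump.lean`, `pairwise_disjoint_fib_tors`). [folklore] -/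
theorem pairwise_disjoint_fibre_translate (z₀ : ℂ) {k : ℕ} (hk : k ≠ 0) :
    Pairwise (Function.onFun Disjoint fun x : Fin k × Fin k ↦
      {y : Y0 N | ∃ τ : ℍ, Y0.mk N τ = y ∧
        D.φ τ = D.uniformize ((z₀ + ((x.1 : ℕ) : ℂ) * D.L.ω₁ + ((x.2 : ℕ) : ℂ) * D.L.ω₂) / (k : ℂ))}) := by
  intro x x' hne
  rw [Function.onFun, Set.disjoint_left]
  rintro y ⟨τ, hy, hτ⟩ ⟨τ', hy', hτ'⟩
  obtain ⟨γ, rfl⟩ := (Y0.mk_eq_mk_iff N τ τ').mp (hy.trans hy'.symm)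
  exact hne (translate_injective D z₀ hk (hτ.symm.trans ((D.φ_gamma0_smul_holds' γ τ').trans hτ')))

/-- The fibre count of `k • φ`: `k² · deg` wherever all `k²` translates are good
(adapted from `Summits/ABC/…/Pump.lean`, `ncard_fibre_smul`). [folklore] -/
theorem ncard_fibre_smul (z₀ : ℂ) {k : ℕ} (hk : k ≠ 0)
    (hgood : ∀ x : Fin k × Fin k, {y : Y0 N | ∃ τ : ℍ, Y0.mk N τ = y ∧
        D.φ τ = D.uniformize ((z₀ + ((x.1 : ℕ) : ℂ) * D.L.ω₁ + ((x.2 : ℕ) : ℂ) * D.L.ω₂) / (k : ℂ))}.ncard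
        = D.deg) :
    {y : Y0 N | ∃ τ : ℍ, Y0.mk N τ = y ∧ k • D.φ τ = D.uniformize z₀}.ncard = k ^ 2 * D.deg := by
  rw [setOf_fibre_smul_eq D z₀ hk,
    Set.ncard_iUnion_of_finite (fun x ↦ Set.finite_of_ncard_pos ((hgood x).symm ▸ D.deg_pos))
      (pairwise_disjoint_fibre_translate D z₀ hk)]
  simp only [hgood]
  rw [finsum_eq_sum_of_fintype, Finset.sum_const, Finset.card_univ, Fintype.card_prod,
    Fintype.card_fin, smul_eq_mul, sq]

/-- **Cofinite fibre count of `k • φ_D`**: all but finitely many `P ∈ E(ℂ)` have exactly `k² · deg D` orbits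
`Γ₀(N)τ` with `k • φ_D(τ) = P` (the field `deg_spec` of the pumped datum of `Summits/ABC/…/Pump.lean`, extracted
as a statement about `D` alone). [folklore] -/
theorem finite_setOf_card_fibre_smul_ne {k : ℕ} (hk : k ≠ 0) :
    {P : (W.baseChange ℂ).toAffine.Point |
      Nat.card {y : Y0 N // ∃ τ : ℍ, Y0.mk N τ = y ∧ k • D.φ τ = P} ≠ k ^ 2 * D.deg}.Finite := by
  have hspec : {Q : (W.baseChange ℂ).toAffine.Point |
      {y : Y0 N | ∃ τ : ℍ, Y0.mk N τ = y ∧ D.φ τ = Q}.ncard ≠ D.deg}.Finite := D.deg_spec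
  refine (hspec.image fun Q ↦ k • Q).subset fun P hP ↦ ?_
  by_contra hP'
  apply hP
  obtain ⟨z₀, rfl⟩ := D.uniformize_surjective P
  have hgood : ∀ x : Fin k × Fin k, {y : Y0 N | ∃ τ : ℍ, Y0.mk N τ = y ∧
      D.φ τ = D.uniformize ((z₀ + ((x.1 : ℕ) : ℂ) * D.L.ω₁ + ((x.2 : ℕ) : ℂ) * D.L.ω₂) / (k : ℂ))}.ncard
      = D.deg := by
    intro x
    by_contra hx
    exact hP' ⟨_, hx, smul_translate D z₀ hk x⟩
  have h := ncard_fibre_smul D z₀ hk hgood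
  rwa [← Nat.card_coe_set_eq] at h

omit [NeZero N] in
/-- Negating the map moves a fibre count to the opposite point. [folklore] -/
theorem card_fibre_neg (g : ℍ → (W.baseChange ℂ).toAffine.Point) (P : (W.baseChange ℂ).toAffine.Point) :
    Nat.card {y : Y0 N // ∃ τ : ℍ, Y0.mk N τ = y ∧ -g τ = P}
      = Nat.card {y : Y0 N // ∃ τ : ℍ, Y0.mk N τ = y ∧ g τ = -P} := by
  simp_rw [neg_eq_iff_eq_neg]

omit [NeZero N] in
/-- A cofinite fibre count for `g` is a cofinite fibre count for `−g` (exceptional set moved by `P ↦ −P`). [folklore] -/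
theorem finite_setOf_card_fibre_neg_ne (g : ℍ → (W.baseChange ℂ).toAffine.Point) (d : ℕ)
    (h : {P : (W.baseChange ℂ).toAffine.Point |
      Nat.card {y : Y0 N // ∃ τ : ℍ, Y0.mk N τ = y ∧ g τ = P} ≠ d}.Finite) :
    {P : (W.baseChange ℂ).toAffine.Point |
      Nat.card {y : Y0 N // ∃ τ : ℍ, Y0.mk N τ = y ∧ -g τ = P} ≠ d}.Finite := by
  refine (h.image Neg.neg).subset fun P hP ↦ ⟨-P, ?_, neg_neg P⟩
  have hP' := hP
  simp only [Set.mem_setOf_eq, card_fibre_neg] at hP'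
  exact hP'

omit [NeZero N] in
/-- **A cofinite fibre count is unique**, because `E(ℂ)` is infinite (`ModularParametrizationData.infinite_point`)
(cf. `deg_unique` of `Summits/ABC/…/Pump.lean`, here for an arbitrary map `g : ℍ → E(ℂ)`). [folklore] -/
theorem cofinite_count_unique (hE : Infinite (W.baseChange ℂ).toAffine.Point)
    (g : ℍ → (W.baseChange ℂ).toAffine.Point) {d₁ d₂ : ℕ}
    (h₁ : {P : (W.baseChange ℂ).toAffine.Point |
      Nat.card {y : Y0 N // ∃ τ : ℍ, Y0.mk N τ = y ∧ g τ = P} ≠ d₁}.Finite)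
    (h₂ : {P : (W.baseChange ℂ).toAffine.Point |
      Nat.card {y : Y0 N // ∃ τ : ℍ, Y0.mk N τ = y ∧ g τ = P} ≠ d₂}.Finite) : d₁ = d₂ := by
  by_contra hne
  haveI := hE
  refine Set.infinite_univ (α := (W.baseChange ℂ).toAffine.Point) ((h₁.union h₂).subset fun P _ ↦ ?_)
  by_cases hP : Nat.card {y : Y0 N // ∃ τ : ℍ, Y0.mk N τ = y ∧ g τ = P} = d₁
  · right
    show Nat.card {y : Y0 N // ∃ τ : ℍ, Y0.mk N τ = y ∧ g τ = P} ≠ d₂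
    rw [hP]; exact hne
  · left; exact hP

end Fibres

section Rigidity

variable {W : WeierstrassCurve ℚ} {N : ℕ} [NeZero N] (D D' : ModularParametrizationData W N)

/-- **Two data carry the same newform** (`q`-expansion principle: both have `q`-expansion `∑ aₙ(W) qⁿ`,
`IsNewformOf.unique`). [cite: DiamondShurman2005, §5.8] -/
theorem newform_eq : D'.f = D.f :=
  D'.isNewformOf.unique D.isNewformOf

/-- **Two data span the same Néron lattice** (uniformisation theorem, uniqueness half:
`IsNeronLatticeOf.lattice_eq`). [cite: SilvermanAEC2009, Thm. VI.5.1 (uniqueness)] -/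
theorem lattice_eq : D'.L.lattice = D.L.lattice :=
  IsNeronLatticeOf.lattice_eq D'.isNeronLattice D.isNeronLattice

/-- `℘` depends on the period pair only through its lattice (adapted from `Summits/ABC/…/Pump.lean`). [folklore] -/
theorem weierstrassP_congr {L L' : PeriodPair} (h : L.lattice = L'.lattice) (z : ℂ) :
    L.weierstrassP z = L'.weierstrassP z := by
  unfold PeriodPair.weierstrassP
  exact congrArg (fun S : Submodule ℤ ℂ ↦ ∑' l : S, (1 / (z - (l : ℂ)) ^ 2 - 1 / (l : ℂ) ^ 2)) h

/-- `℘'` depends on the period pair only through its lattice (adapted from `Summits/ABC/…/Pump.lean`). [folklore] -/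
theorem derivWeierstrassP_congr {L L' : PeriodPair} (h : L.lattice = L'.lattice) (z : ℂ) :
    L.derivWeierstrassP z = L'.derivWeierstrassP z := by
  unfold PeriodPair.derivWeierstrassP
  exact congrArg (fun S : Submodule ℤ ℂ ↦ - ∑' l : S, 2 / (z - (l : ℂ)) ^ 3) h

/-- **Two data have the same uniformisation `ℂ →+ E(ℂ)`**: both vanish exactly on the common Néron lattice and are
the `℘`-map off it (`uniformize_spec`) (cf. `uniformize_eq_of_lattice_eq` of `Summits/ABC/…/Pump.lean`).
[cite: SilvermanAEC2009, Prop. VI.3.6 (b)] -/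
theorem uniformize_eq : D'.uniformize = D.uniformize := by
  have hL : D'.L.lattice = D.L.lattice := lattice_eq D D'
  ext1 z
  by_cases hz : z ∈ D.L.lattice
  · rw [(D.uniformize_eq_zero_iff z).mpr hz, (D'.uniformize_eq_zero_iff z).mpr (hL ▸ hz)]
  · obtain ⟨h, e⟩ := D.uniformize_spec z hz
    obtain ⟨h', e'⟩ := D'.uniformize_spec z (hL ▸ hz)
    rw [e, e', WeierstrassCurve.Affine.Point.some.injEq]
    simp only [weierstrassP_congr hL, derivWeierstrassP_congr hL, and_self]

/-- **`φ_{D'}` in the currency of `D`**: `φ_{D'}(τ) = u_D (c' · 2πi ∫_{i∞}^τ f_D)` — only the Manin constant differs.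
[cite: CremonaAlgorithms1997, §2.10] -/
theorem φ_eq_uniformize (τ : ℍ) : D'.φ τ = D.uniformize ((D'.c : ℂ) * eichlerIntegral D.f τ) := by
  show D'.uniformize ((D'.c : ℂ) * eichlerIntegral D'.f τ) = _
  rw [uniformize_eq D D', newform_eq D D']

/-- **The symmetric pump, pointwise**: `|c'| • φ_D = |c| • φ_{D'}` or `|c'| • φ_D = −(|c| • φ_{D'})` on all of `ℍ`
(according as `c c' > 0` or `< 0`). [cite: EdixhovenManin1991, §1] -/
theorem natAbs_smul_φ_eq_or :
    (∀ τ : ℍ, D'.c.natAbs • D.φ τ = D.c.natAbs • D'.φ τ) ∨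
    (∀ τ : ℍ, D'.c.natAbs • D.φ τ = -(D.c.natAbs • D'.φ τ)) := by
  have eφ : ∀ τ : ℍ, D.φ τ = D.uniformize ((D.c : ℂ) * eichlerIntegral D.f τ) := fun τ ↦ rfl
  have eφ' := φ_eq_uniformize D D'
  have hs : ∀ (n : ℕ) (a : ℂ), n • D.uniformize a = D.uniformize ((n : ℂ) * a) := fun n a ↦ by
    rw [← map_nsmul, nsmul_eq_mul]
  rcases Int.natAbs_eq D.c with h | h <;> rcases Int.natAbs_eq D'.c with h' | h'
  · left
    intro τ
    have hc : (D.c : ℂ) = (D.c.natAbs : ℂ) := by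
      have := congrArg (Int.cast : ℤ → ℂ) h; rwa [Int.cast_natCast] at this
    have hc' : (D'.c : ℂ) = (D'.c.natAbs : ℂ) := by
      have := congrArg (Int.cast : ℤ → ℂ) h'; rwa [Int.cast_natCast] at this
    rw [eφ, eφ', hs, hs, hc, hc']
    congr 1
    ring
  · right
    intro τ
    have hc : (D.c : ℂ) = (D.c.natAbs : ℂ) := by
      have := congrArg (Int.cast : ℤ → ℂ) h; rwa [Int.cast_natCast] at this
    have hc' : (D'.c : ℂ) = -(D'.c.natAbs : ℂ) := by
      have := congrArg (Int.cast : ℤ → ℂ) h'; rwa [Int.cast_neg, Int.cast_natCast] at this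
    rw [eφ, eφ', hs, hs, hc, hc', ← map_neg]
    congr 1
    ring
  · right
    intro τ
    have hc : (D.c : ℂ) = -(D.c.natAbs : ℂ) := by
      have := congrArg (Int.cast : ℤ → ℂ) h; rwa [Int.cast_neg, Int.cast_natCast] at this
    have hc' : (D'.c : ℂ) = (D'.c.natAbs : ℂ) := by
      have := congrArg (Int.cast : ℤ → ℂ) h'; rwa [Int.cast_natCast] at this
    rw [eφ, eφ', hs, hs, hc, hc', ← map_neg]
    congr 1
    ring
  · left
    intro τ
    have hc : (D.c : ℂ) = -(D.c.natAbs : ℂ) := by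
      have := congrArg (Int.cast : ℤ → ℂ) h; rwa [Int.cast_neg, Int.cast_natCast] at this
    have hc' : (D'.c : ℂ) = -(D'.c.natAbs : ℂ) := by
      have := congrArg (Int.cast : ℤ → ℂ) h'; rwa [Int.cast_neg, Int.cast_natCast] at this
    rw [eφ, eφ', hs, hs, hc, hc']
    congr 1
    ring

/-- ★ **RIGIDITY IDENTITY `|c'|² · deg D = |c|² · deg D'`** for any two modular parametrisation data of the same
model and level: the cofinite fibre count of the common map `|c'| • φ_D = ±(|c| • φ_{D'})` is computed both ways
(`finite_setOf_card_fibre_smul_ne`) and a cofinite count is unique (`cofinite_count_unique`).  So `deg / c²` is an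
invariant of `(W, N)`: a datum has no freedom beyond pumping its Manin constant.
[cite: EdixhovenManin1991, §1] [cite: CremonaAlgorithms1997, §2.10] -/
theorem natAbs_maninConstant_sq_mul_deg_eq : D'.c.natAbs ^ 2 * D.deg = D.c.natAbs ^ 2 * D'.deg := by
  have ha : D.c.natAbs ≠ 0 := Int.natAbs_ne_zero.mpr D.maninConstant_ne_zero_holds
  have hb : D'.c.natAbs ≠ 0 := Int.natAbs_ne_zero.mpr D'.maninConstant_ne_zero_holds
  have h₁ := finite_setOf_card_fibre_smul_ne D hb
  have h₂ := finite_setOf_card_fibre_smul_ne D' ha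
  rcases natAbs_smul_φ_eq_or D D' with h | h
  · refine cofinite_count_unique D.infinite_point (fun τ ↦ D'.c.natAbs • D.φ τ) h₁ ?_
    show {P : (W.baseChange ℂ).toAffine.Point |
      Nat.card {y : Y0 N // ∃ τ : ℍ, Y0.mk N τ = y ∧ D'.c.natAbs • D.φ τ = P} ≠ D.c.natAbs ^ 2 * D'.deg}.Finite
    simp_rw [h]
    exact h₂
  · refine cofinite_count_unique D.infinite_point (fun τ ↦ D'.c.natAbs • D.φ τ) h₁ ?_
    show {P : (W.baseChange ℂ).toAffine.Point |
      Nat.card {y : Y0 N // ∃ τ : ℍ, Y0.mk N τ = y ∧ D'.c.natAbs • D.φ τ = P} ≠ D.c.natAbs ^ 2 * D'.deg}.Finite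
    simp_rw [h]
    exact finite_setOf_card_fibre_neg_ne (fun τ ↦ D.c.natAbs • D'.φ τ) _ h₂

/-- The rigidity identity over `ℤ`: `c'² · deg D = c² · deg D'`. [cite: EdixhovenManin1991, §1] -/
theorem maninConstant_sq_mul_deg_eq : D'.c ^ 2 * (D.deg : ℤ) = D.c ^ 2 * (D'.deg : ℤ) := by
  have h := congrArg (Nat.cast : ℕ → ℤ) (natAbs_maninConstant_sq_mul_deg_eq D D')
  push_cast at h
  rw [sq_abs, sq_abs] at h
  exact h

/-- **Equal degrees force equal Manin constants up to sign.** [cite: EdixhovenManin1991, §1] -/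
theorem maninConstant_eq_or_eq_neg_of_deg_eq (hdeg : D'.deg = D.deg) : D'.c = D.c ∨ D'.c = -D.c := by
  have h := natAbs_maninConstant_sq_mul_deg_eq D D'
  rw [hdeg] at h
  have h2 : D'.c.natAbs ^ 2 = D.c.natAbs ^ 2 := Nat.eq_of_mul_eq_mul_right D.deg_pos h
  have h1 : D'.c.natAbs = D.c.natAbs := Nat.pow_left_injective two_ne_zero h2
  exact Int.natAbs_eq_natAbs_iff.mp h1

/-- ★ **Two data of the same degree have the same parametrisation up to sign**: `φ_{D'} = φ_D` or `φ_{D'} = −φ_D`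
pointwise on `ℍ`. [cite: EdixhovenManin1991, §1] [cite: CremonaAlgorithms1997, §2.10] -/
theorem φ_eq_or_eq_neg_of_deg_eq (hdeg : D'.deg = D.deg) :
    (∀ τ : ℍ, D'.φ τ = D.φ τ) ∨ (∀ τ : ℍ, D'.φ τ = -D.φ τ) := by
  rcases maninConstant_eq_or_eq_neg_of_deg_eq D D' hdeg with hc | hc
  · left
    intro τ
    rw [φ_eq_uniformize D D', hc]
    rfl
  · right
    intro τ
    rw [φ_eq_uniformize D D', hc, Int.cast_neg, neg_mul, map_neg]
    rfl

/-- **A datum whose Manin constant is a multiple of another's has the multiplied parametrisation**: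
`c' = m c ⟹ φ_{D'} = m • φ_D`. [cite: EdixhovenManin1991, §1] -/
theorem φ_eq_zsmul_of_maninConstant_eq_mul {m : ℤ} (hc : D'.c = m * D.c) (τ : ℍ) : D'.φ τ = m • D.φ τ := by
  rw [φ_eq_uniformize D D', hc]
  show _ = m • D.uniformize ((D.c : ℂ) * eichlerIntegral D.f τ)
  rw [← map_zsmul, zsmul_eq_mul]
  congr 1
  push_cast
  ring

end Rigidity

end Summit.BirchSwinnertonDyer.BirchSwinnertonDyer.Theorems.SylvesterTwoParamRigidity

end
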